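/-
Copyright (c) 2026 the pub-hodgecm-mathlib formalisation cell (harness21).  Prover seat hodgecm-mathlib-K2Liu-p11 (g2), Track B «K2-LIT»,
#184♮ = hLiu418 = `stmt-HodgeConjecture-24832`; LEAD F0P6-plan (g13) 10:13:40Z (Q2)(Q3)(B) «the explicit Lie derivative
`Y • f⁰_{s,k} = λ_k(s) · f_{s,τ′}` for `Y ∈ 𝔭^±` in tube coordinates» (row `K2LiuArchIntertwiningLieEquivariance` = (A) K2E5-p16 +
(B) this lineage), FILE 2 of 2: the `𝔭^±`- and `𝔨`-DERIVATIVES with their AFFINE scalars.  THEOREMS ONLY (no `def`, no `instance`, no notation,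
no named-fact hypothesis, no `sorry`; no matrix norm in any statement).
-/
import Summits.HodgeConjecture.HodgeConjecture.Theorems.K2LiuArchScalarSectionCurveDerivative   -- ★ (this seat) FILE 1: master formula
import HarnessLib

/-!
# Crux `HLiu418`, A∞ organ: `𝔭^±(b) • f⁰_{s,k} = λ^±_k(s) · (f⁰_{s,k} · explicit carrier)`, `λ^−_k(s) = 2s + l − k`, `λ^+_k(s) = 2s + l + k`

Cell `hodgecm-mathlib`, crux item hLiu418 = `stmt-HodgeConjecture-24832` (helper lane `--supports`, count-neutral).

Letters as in FILE 1 (★ `K2LiuArchScalarSectionCurveDerivative`): `Δ_g = denom g (i1)`, `f⁰_{s,k} = archScalarSection k s`, `μ b = (b 0; 0 −b)`,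
`σ b = (0 b; b 0)`, `κ b = (0 b; −b 0)`, `𝔭^∓(b) = μ b ∓ i σ b`; `D_W f⁰(g) = d∕dt|₀ f⁰(g γ_t)` along any entrywise-`C¹` curve through `1`
with velocity `W`, and `𝔭^∓(b) • f⁰ := D_{μ b} f⁰ ∓ i·D_{σ b} f⁰` (the `𝔤_ℂ`-action assembled from REAL letters).  With
`T_b(g) = tr(Δ_g⁻¹ · denom g (−i1) · b)` and `m = k − 2s − l`:
* `lieDeriv_pMinus`: `D_{μb} f⁰ − i D_{σb} f⁰ = (2s + l − k) · f⁰_{s,k}(g) · conj (T_b g)` — `λ⁻_k(s) = 2s + l − k`, zero at `s = (k−l)∕2`;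
* `lieDeriv_pPlus`:  `D_{μb} f⁰ + i D_{σb} f⁰ = (2s + l + k) · f⁰_{s,k}(g) · T_b g`        — `λ⁺_k(s) = 2s + l + k`;
* `lieDeriv_kappa_exp`: `D_{κb} f⁰ = i·k·tr(b)·f⁰_{s,k}(g)` for `tr b` real — the scalar `K_w`-type letter of ★ H1-E `lieDeriv_kappa`, recovered
  on the explicit vector;
* the `exp`-curve instances, and the two numbers the (CR-loc) recursion `n_{τ′}(s)·λ(s) = n_k(s)·λ(−s)` consumes for `U(2,2)` and the
  Gaussian line type `k₀ = 1`: `λ⁻_1(−½) = 0` (the LINE VACUUM `f⁰_{−½,1}` is `𝔭⁻`-killed) and `λ⁻_1(½) = 2 ≠ 0`.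
So `𝔭⁻(b) • f⁰_{s,k} = λ⁻_k(s) · φ⁻_{b,s}` with carrier `φ⁻_{b,s} = f⁰_{s,k} · conj T_b`, whose `K_w`-restriction does not depend on `s`
(`f⁰_{s,k}|_{K_w} = j^{−k}`): the shape `Y • f⁰_{s,k} = λ_k(s) · f_{s,τ′}` of the LEAD's letter, with `λ` affine.
References: [Shimura1997, §§5–6, §16.4]; [Knapp1986, Ch. VI §2]; [Bump1997, §2.1].
HONEST LABEL: HC_CM is proved only modulo the 7 printed citations (2 remaining named inputs: hLiu418 = stmt-HodgeConjecture-24832,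
h413 = stmt-HodgeConjecture-24833) until rung 0 closes; count-neutral helper, closes no socket.
-/

set_option autoImplicit false
set_option linter.dupNamespace false

noncomputable section

open Complex Matrix Filter NormedSpace
open scoped ComplexConjugate Topology

namespace Summit.HodgeConjecture.HodgeConjecture.Cruxes.HLiu418.K2LiuArchScalarSectionPDerivative

open Literature.NumberTheory.ModularForms.SiegelUpperHalfSpace (denom)
open Summit.HodgeConjecture.HodgeConjecture.Cruxes.HLiu418.K2LiuArchInducedTubeDefs
open Summit.HodgeConjecture.HodgeConjecture.Cruxes.HLiu418.K2LiuArchScalarSectionCurveDerivative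

variable {l : Type*} [Fintype l] [DecidableEq l]

/-! ## §4  The `𝔭^±`- and `𝔨`-derivatives of `f⁰_{s,k}` -/

/-- The trace letters of `μ b` and `σ b` combine: `τ(μ b) − i τ(σ b) = 0` and `τ(μ b) + i τ(σ b) = −2 T_b`,
`T_b = tr(Δ_g⁻¹ · denom g (−i1) · b)`. [Shimura1997, §6] -/
theorem trace_letters_mu_sigma (g : Matrix (l ⊕ l) (l ⊕ l) ℂ) (b : Matrix l l ℂ) :
    ((denom g (I • (1 : Matrix l l ℂ)))⁻¹ * denom (g * fromBlocks b 0 0 (-b)) (I • (1 : Matrix l l ℂ))).trace -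
        I * ((denom g (I • (1 : Matrix l l ℂ)))⁻¹ * denom (g * fromBlocks 0 b b 0) (I • (1 : Matrix l l ℂ))).trace = 0 ∧
      ((denom g (I • (1 : Matrix l l ℂ)))⁻¹ * denom (g * fromBlocks b 0 0 (-b)) (I • (1 : Matrix l l ℂ))).trace +
        I * ((denom g (I • (1 : Matrix l l ℂ)))⁻¹ * denom (g * fromBlocks 0 b b 0) (I • (1 : Matrix l l ℂ))).trace =
        -(2 * ((denom g (I • (1 : Matrix l l ℂ)))⁻¹ * denom g (-(I • (1 : Matrix l l ℂ))) * b).trace) := by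
  set Δ : Matrix l l ℂ := denom g (I • (1 : Matrix l l ℂ)) with hΔ
  have hminus := denom_mul_mu_sub_I_smul_sigma g b
  have hplus := denom_mul_mu_add_I_smul_sigma g b
  rw [Matrix.mul_sub, denom_sub, denom_mul_smul] at hminus
  rw [Matrix.mul_add, denom_add, denom_mul_smul] at hplus
  constructor
  · have h := congrArg (fun M : Matrix l l ℂ => (Δ⁻¹ * M).trace) hminus
    simp only [Matrix.mul_sub, Matrix.mul_smul, Matrix.trace_sub, Matrix.trace_smul, smul_eq_mul, Matrix.mul_zero,
      Matrix.trace_zero] at h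
    exact h
  · have h := congrArg (fun M : Matrix l l ℂ => (Δ⁻¹ * M).trace) hplus
    simp only [Matrix.mul_add, Matrix.mul_smul, Matrix.trace_add, Matrix.trace_smul, smul_eq_mul, Matrix.mul_neg,
      Matrix.trace_neg] at h
    rw [← Matrix.mul_assoc] at h
    rw [h]

/-- The `𝔭^∓` bookkeeping: with `τμ − iτσ = 0`, `τμ + iτσ = −2T`,
`f·((a)τμ + (c)conj τμ) − i·f·((a)τσ + (c)conj τσ) = −2c·f·conj T`. [folklore] -/
theorem pMinus_algebra (f a c τμ τσ T : ℂ) (h1 : τμ - I * τσ = 0) (h2 : τμ + I * τσ = -(2 * T)) :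
    f * (a * τμ + c * conj τμ) - I * (f * (a * τσ + c * conj τσ)) = -(2 * c) * f * conj T := by
  have hμ : τμ = -T := by linear_combination (h1 + h2) / 2
  have hσ : τσ = I * T := by
    have hI : I * I = -1 := Complex.I_mul_I
    linear_combination (I * h1 - I * h2) / 2 + (τσ) * hI
  subst hμ
  rw [hσ, map_neg, map_mul, Complex.conj_I]
  have hI : I * I = -1 := Complex.I_mul_I
  linear_combination (f * (c * conj T - a * T)) * hI

/-- The `𝔭^+` bookkeeping: `f·((a)τμ + (c)conj τμ) + i·f·((a)τσ + (c)conj τσ) = −2a·f·T`. [folklore] -/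
theorem pPlus_algebra (f a c τμ τσ T : ℂ) (h1 : τμ - I * τσ = 0) (h2 : τμ + I * τσ = -(2 * T)) :
    f * (a * τμ + c * conj τμ) + I * (f * (a * τσ + c * conj τσ)) = -(2 * a) * f * T := by
  have hμ : τμ = -T := by linear_combination (h1 + h2) / 2
  have hσ : τσ = I * T := by
    have hI : I * I = -1 := Complex.I_mul_I
    linear_combination (I * h1 - I * h2) / 2 + (τσ) * hI
  subst hμ
  rw [hσ, map_neg, map_mul, Complex.conj_I]
  have hI : I * I = -1 := Complex.I_mul_I
  linear_combination (f * (a * T - c * conj T)) * hI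

/-- **THE `𝔭⁻`-DERIVATIVE OF THE SCALAR-TYPE VECTOR** (generic rank; any entrywise-`C¹` curves `γμ`, `γσ` through `1` with velocities
`μ b = (b 0; 0 −b)`, `σ b = (0 b; b 0)`; any `g` with `j(g,i1) ≠ 0`; any `b ∈ M_l(ℂ)`):
`D_{μ b} f⁰_{s,k}(g) − i·D_{σ b} f⁰_{s,k}(g) = (2s + l − k) · f⁰_{s,k}(g) · conj tr(Δ_g⁻¹ · denom g (−i1) · b)`.
So `𝔭⁻(b) • f⁰_{s,k} = λ⁻_k(s) · φ⁻_{b,s}` with the AFFINE `λ⁻_k(s) = 2s + l − k` and the carrier `φ⁻_{b,s} = f⁰_{s,k} · conj T_b`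
(`K_w`-restriction independent of `s`).  [Shimura1997, §16.4; Knapp1986, Ch. VI §2; Bump1997, §2.1] -/
theorem lieDeriv_pMinus (k : ℤ) (s : ℂ) {g : Matrix (l ⊕ l) (l ⊕ l) ℂ} (hg : (denom g (I • (1 : Matrix l l ℂ))).det ≠ 0)
    (b : Matrix l l ℂ) {γμ γσ : ℝ → Matrix (l ⊕ l) (l ⊕ l) ℂ} (hμ0 : γμ 0 = 1) (hσ0 : γσ 0 = 1)
    (hμ : ∀ i j, HasDerivAt (fun t => γμ t i j) ((fromBlocks b 0 0 (-b) : Matrix (l ⊕ l) (l ⊕ l) ℂ) i j) 0)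
    (hσ : ∀ i j, HasDerivAt (fun t => γσ t i j) ((fromBlocks 0 b b 0 : Matrix (l ⊕ l) (l ⊕ l) ℂ) i j) 0) :
    deriv (fun t : ℝ => archScalarSection k s (g * γμ t)) 0 - I * deriv (fun t : ℝ => archScalarSection k s (g * γσ t)) 0 =
      (2 * s + (Fintype.card l : ℂ) - k) * archScalarSection k s g *
        conj ((denom g (I • (1 : Matrix l l ℂ)))⁻¹ * denom g (-(I • (1 : Matrix l l ℂ))) * b).trace := by
  rw [(hasDerivAt_archScalarSection_mul_curve k s hg hμ0 hμ).deriv, (hasDerivAt_archScalarSection_mul_curve k s hg hσ0 hσ).deriv]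
  obtain ⟨h1, h2⟩ := trace_letters_mu_sigma g b
  rw [pMinus_algebra _ _ _ _ _ _ h1 h2]
  ring

/-- **THE `𝔭⁺`-DERIVATIVE OF THE SCALAR-TYPE VECTOR**:
`D_{μ b} f⁰_{s,k}(g) + i·D_{σ b} f⁰_{s,k}(g) = (2s + l + k) · f⁰_{s,k}(g) · tr(Δ_g⁻¹ · denom g (−i1) · b)` — `λ⁺_k(s) = 2s + l + k`.
[Shimura1997, §16.4; Knapp1986, Ch. VI §2] -/
theorem lieDeriv_pPlus (k : ℤ) (s : ℂ) {g : Matrix (l ⊕ l) (l ⊕ l) ℂ} (hg : (denom g (I • (1 : Matrix l l ℂ))).det ≠ 0)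
    (b : Matrix l l ℂ) {γμ γσ : ℝ → Matrix (l ⊕ l) (l ⊕ l) ℂ} (hμ0 : γμ 0 = 1) (hσ0 : γσ 0 = 1)
    (hμ : ∀ i j, HasDerivAt (fun t => γμ t i j) ((fromBlocks b 0 0 (-b) : Matrix (l ⊕ l) (l ⊕ l) ℂ) i j) 0)
    (hσ : ∀ i j, HasDerivAt (fun t => γσ t i j) ((fromBlocks 0 b b 0 : Matrix (l ⊕ l) (l ⊕ l) ℂ) i j) 0) :
    deriv (fun t : ℝ => archScalarSection k s (g * γμ t)) 0 + I * deriv (fun t : ℝ => archScalarSection k s (g * γσ t)) 0 =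
      (2 * s + (Fintype.card l : ℂ) + k) * archScalarSection k s g *
        ((denom g (I • (1 : Matrix l l ℂ)))⁻¹ * denom g (-(I • (1 : Matrix l l ℂ))) * b).trace := by
  rw [(hasDerivAt_archScalarSection_mul_curve k s hg hμ0 hμ).deriv, (hasDerivAt_archScalarSection_mul_curve k s hg hσ0 hσ).deriv]
  obtain ⟨h1, h2⟩ := trace_letters_mu_sigma g b
  rw [pPlus_algebra _ _ _ _ _ _ h1 h2]
  ring

/-- **`𝔭⁻`-DERIVATIVE ALONG THE `exp` CURVES OF RECORD** (`γμ = exp (t μb)`, `γσ = exp (t σb)`). [Shimura1997, §16.4] -/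
theorem lieDeriv_pMinus_exp (k : ℤ) (s : ℂ) {g : Matrix (l ⊕ l) (l ⊕ l) ℂ} (hg : (denom g (I • (1 : Matrix l l ℂ))).det ≠ 0)
    (b : Matrix l l ℂ) :
    deriv (fun t : ℝ => archScalarSection k s (g * exp (t • (fromBlocks b 0 0 (-b) : Matrix (l ⊕ l) (l ⊕ l) ℂ)))) 0 -
        I * deriv (fun t : ℝ => archScalarSection k s (g * exp (t • (fromBlocks 0 b b 0 : Matrix (l ⊕ l) (l ⊕ l) ℂ)))) 0 =
      (2 * s + (Fintype.card l : ℂ) - k) * archScalarSection k s g *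
        conj ((denom g (I • (1 : Matrix l l ℂ)))⁻¹ * denom g (-(I • (1 : Matrix l l ℂ))) * b).trace :=
  lieDeriv_pMinus k s hg b (exp_zero_smul_eq_one _) (exp_zero_smul_eq_one _) (hasDerivAt_exp_smul_entry _)
    (hasDerivAt_exp_smul_entry _)

/-- **`𝔭⁺`-DERIVATIVE ALONG THE `exp` CURVES OF RECORD.** [Shimura1997, §16.4] -/
theorem lieDeriv_pPlus_exp (k : ℤ) (s : ℂ) {g : Matrix (l ⊕ l) (l ⊕ l) ℂ} (hg : (denom g (I • (1 : Matrix l l ℂ))).det ≠ 0)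
    (b : Matrix l l ℂ) :
    deriv (fun t : ℝ => archScalarSection k s (g * exp (t • (fromBlocks b 0 0 (-b) : Matrix (l ⊕ l) (l ⊕ l) ℂ)))) 0 +
        I * deriv (fun t : ℝ => archScalarSection k s (g * exp (t • (fromBlocks 0 b b 0 : Matrix (l ⊕ l) (l ⊕ l) ℂ)))) 0 =
      (2 * s + (Fintype.card l : ℂ) + k) * archScalarSection k s g *
        ((denom g (I • (1 : Matrix l l ℂ)))⁻¹ * denom g (-(I • (1 : Matrix l l ℂ))) * b).trace :=
  lieDeriv_pPlus k s hg b (exp_zero_smul_eq_one _) (exp_zero_smul_eq_one _) (hasDerivAt_exp_smul_entry _)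
    (hasDerivAt_exp_smul_entry _)

/-- **THE `𝔨`-LETTER, RECOVERED**: along `κ b = (0 b; −b 0)`,
`D_{κ b} f⁰_{s,k}(g) = f⁰_{s,k}(g) · ((m∕2 − k)(−i tr b) + (m∕2)·conj(−i tr b))`; for hermitian `b` (`tr b` real) this is
`i·k·tr(b)·f⁰_{s,k}(g)` — the scalar `K_w`-type `k` (★ H1-E `lieDeriv_kappa`'s letter on the explicit vector). [Shimura1997, §16.4] -/
theorem lieDeriv_kappa_exp (k : ℤ) (s : ℂ) {g : Matrix (l ⊕ l) (l ⊕ l) ℂ} (hg : (denom g (I • (1 : Matrix l l ℂ))).det ≠ 0)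
    {b : Matrix l l ℂ} (hb : conj b.trace = b.trace) :
    deriv (fun t : ℝ => archScalarSection k s (g * exp (t • (fromBlocks 0 b (-b) 0 : Matrix (l ⊕ l) (l ⊕ l) ℂ)))) 0 =
      I * k * b.trace * archScalarSection k s g := by
  rw [(hasDerivAt_archScalarSection_mul_exp k s hg (fromBlocks 0 b (-b) 0)).deriv, denom_mul_kappa, Matrix.mul_neg, Matrix.mul_smul,
    ← Matrix.mul_assoc, Matrix.nonsing_inv_mul _ (isUnit_iff_ne_zero.mpr hg), Matrix.one_mul, Matrix.trace_neg, Matrix.trace_smul,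
    smul_eq_mul, map_neg, map_mul, Complex.conj_I, hb]
  ring

/-! ## §5  The two numbers the (CR-loc) recursion consumes (`U(2,2)`, Gaussian line type `k₀ = 1`) -/

/-- For `U(2,2)` the rank letter is `l = 2`. [folklore] -/
theorem card_fin_two_cast : ((Fintype.card (Fin 2) : ℕ) : ℂ) = 2 := by
  rw [Fintype.card_fin]
  norm_num

/-- **THE LINE VACUUM IS `𝔭⁻`-KILLED**: `λ⁻_1(−½) = 2(−½) + 2 − 1 = 0` — at `s = −½` the weight-one vector `f⁰_{−½,1}` of `U(2,2)`
(the archimedean Gaussian of the line, a holomorphic weight-one section) is annihilated by `𝔭⁻`. [Shimura1997, §16.4] -/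
theorem lambdaMinus_line_neg_half : 2 * (-(1 / 2 : ℂ)) + ((Fintype.card (Fin 2) : ℕ) : ℂ) - ((1 : ℤ) : ℂ) = 0 := by
  rw [card_fin_two_cast]
  push_cast
  ring

/-- **AT `s = ½` THE `𝔭⁻`-DERIVATIVE OF `f⁰_{½,1}` DOES NOT VANISH**: `λ⁻_1(½) = 2`. [Shimura1997, §16.4] -/
theorem lambdaMinus_line_half : 2 * (1 / 2 : ℂ) + ((Fintype.card (Fin 2) : ℕ) : ℂ) - ((1 : ℤ) : ℂ) = 2 := by
  rw [card_fin_two_cast]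
  push_cast
  ring

/-- The mirror line type `k₀ = −1` is `𝔭⁺`-killed at `s = −½`: `λ⁺_{−1}(−½) = 0`. [Shimura1997, §16.4] -/
theorem lambdaPlus_mirror_neg_half : 2 * (-(1 / 2 : ℂ)) + ((Fintype.card (Fin 2) : ℕ) : ℂ) + ((-1 : ℤ) : ℂ) = 0 := by
  rw [card_fin_two_cast]
  push_cast
  ring

end Summit.HodgeConjecture.HodgeConjecture.Cruxes.HLiu418.K2LiuArchScalarSectionPDerivative

end
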